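import Summits.QuantumFields.YangMills.Theorems.AllWindowsColdBoxBoxHighLineStep2Wick
import Summits.QuantumFields.YangMills.Theorems.AllWindowsColdBoxBoxHighLineEdgeChartTwoVertex

/-!
# T-S5.12a, part 1 — the triple-product vertex `tripleForm T (plaqVar H x μ ν a)` as a finite sum of COLOUR-DISTINCT cubic monomials in the
# free edge variables, and the «triple bond» bound for a pair of such vertices

Planner ym-idea-2 g18's `TaskS5Step2Wick.lean` (✓`…Step2Wick`, w3 g40): the cubic Taylor term of the Wilson plaquette cost in the edge chart is
`tripleForm T v = Σ_{ijk} T_{ijk} · v_i · (v_j × v_k)` in the four edge variables `v = plaqVar H x μ ν a` (7a), and 12a `CubicVariance` /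
T-S5.10 `CubicDecorrelation` need `E₀[(β Σ_p tripleForm …)²] ≲ H⁴(1+log H)^m/β`.  This file supplies the structural half:

* `freeVec_apply_eq_sum` — a chart edge variable is `Σ_{e free} [e = edge]·a_e` (zero on pinned / non-block edges);
* `triple_product_expansion` — `u·(v × w) = Σ_{t<6} ±u_{c_t 0} v_{c_t 1} w_{c_t 2}` with `c_t` a PERMUTATION of the colours (packaged existentially);
* ★`tripleForm_plaqVar_expansion` — `tripleForm T (plaqVar H x μ ν a) = Σ_k cA_k · ∏_{s<3} a_{leg k s}` over a finite index type, with
  `Σ_k |cA_k| ≤ 384·B` (`|T| ≤ B`), pairwise-DISTINCT colours inside every monomial, and every leg of a non-zero monomial sitting on an edge of the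
  plaquette;
* ★`abs_integral_tripleForm_mul_tripleForm_le` — for two plaquettes and a common bound `M` on the cross propagators
  `(2β)⁻¹[c=c']G_H(e,e')` between their edges: `|∫ P_p · P_{p'} · e^{−βQ} da| ≤ Z · 15·M³ · (384B)²` (✓`abs_integral_prod_mul_prod_le`, k = 3:
  colour-distinct vertices only cross-contract).

Tree (✓Step2Wick, ✓EdgeChartTwoVertex) + Mathlib; no definitions.  HONEST LABEL: bookkeeping for 12a/10 of STEP 2 of the XL stub S5 of a critic-PASSed DRAFT
line; 7a, 12a, 10, S5, U5, ⟨24004⟩ ⟨24335⟩ ⟨24336⟩ remain OPEN; route AllWindowsColdBox is DRAFT; no rung is proved; the Yang–Mills mass gap is NOT proved by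
this file.  Seat ym-line-sfw-p2 g77 (LEAD, cell ym-idea-1; Wick layer T-S5.10/11/12a).
-/

set_option autoImplicit false

noncomputable section

open MeasureTheory Matrix Finset
open scoped Kronecker Nat Matrix
open Literature.Probability.LatticeModels (Site)

namespace Summit.QuantumFields.YangMills.Theorems.AllWindowsColdBoxBoxHighLine

namespace EdgeChartGaussian

/-! ## §1 Chart edge variables as sums over the free edges -/

/-- At most one free edge has a given underlying lattice edge. -/
theorem landauFree_ext {H : ℕ} {e e' : LandauFree H}
    (h : (e.1.1 : Literature.MathematicalPhysics.QuantumLattice.ZdEdge 4) = e'.1.1) : e = e' :=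
  Subtype.ext (Subtype.ext h)

/-- ★ A chart edge variable is the indicator-weighted sum over the free edges: `(freeVec H a ed)_c = Σ_{e free} [e = ed] · (a e)_c`. -/
theorem freeVec_apply_eq_sum (H : ℕ) (a : LandauFree H → E3) (ed : Literature.MathematicalPhysics.QuantumLattice.ZdEdge 4) (c : Fin 3) :
    freeVec H a ed c =
      ∑ e : LandauFree H, if (e.1.1 : Literature.MathematicalPhysics.QuantumLattice.ZdEdge 4) = ed then a e c else 0 := by
  classical
  unfold freeVec
  split_ifs with h h'
  · rw [Finset.sum_eq_single (⟨⟨ed, h⟩, not_not_intro h'⟩ : LandauFree H)]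
    · simp
    · intro e _ hne
      rw [if_neg]
      intro heq
      exact hne (landauFree_ext heq)
    · intro hmem; exact absurd (Finset.mem_univ _) hmem
  · rw [Finset.sum_eq_zero fun e _ => ?_]
    · rfl
    rw [if_neg]
    intro heq
    exact e.2 (by rw [heq]; exact h')
  · rw [Finset.sum_eq_zero fun e _ => ?_]
    · rfl
    rw [if_neg]
    intro heq
    exact h (heq ▸ e.1.2)

/-! ## §2 The triple product as six colour-distinct monomials -/

/-- ★ `u·(v × w) = Σ_{t<6} σ_t · u_{c_t 0} v_{c_t 1} w_{c_t 2}` with each `c_t` injective (a permutation of the three colours) and `|σ_t| = 1`. -/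
theorem triple_product_expansion :
    ∃ (col : Fin 6 → Fin 3 → Fin 3) (sg : Fin 6 → ℝ), (∀ t, Function.Injective (col t)) ∧ (∀ t, |sg t| = 1) ∧
      ∀ u v w : Fin 3 → ℝ, u ⬝ᵥ (v ⨯₃ w) = ∑ t : Fin 6, sg t * (u (col t 0) * v (col t 1) * w (col t 2)) := by
  refine ⟨![![0, 1, 2], ![0, 2, 1], ![1, 2, 0], ![1, 0, 2], ![2, 0, 1], ![2, 1, 0]], ![1, -1, 1, -1, 1, -1], ?_, ?_, ?_⟩
  · intro t
    fin_cases t <;> decide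
  · intro t
    fin_cases t <;> simp
  · intro u v w
    rw [cross_apply]
    simp [dotProduct, Fin.sum_univ_succ]
    ring

/-! ## §3 The vertex as a sum of colour-distinct cubic monomials in the free variables -/

/-- ★ **Monomial expansion of the triple-product vertex.**  For every plaquette `(x, μ, ν)` and coefficients `|T_{ijk}| ≤ B` there are finitely many
monomials `cA_k · a_{leg k 0} a_{leg k 1} a_{leg k 2}` with `Σ|cA_k| ≤ 384·B`, pairwise-distinct colours, and (when `cA_k ≠ 0`) all legs on edges of the
plaquette, summing to `tripleForm T (plaqVar H x μ ν a)` for every field `a`. -/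
theorem tripleForm_plaqVar_expansion (H : ℕ) (x : Site 4) (μ ν : Fin 4) (T : Fin 4 → Fin 4 → Fin 4 → ℝ) {B : ℝ}
    (hT : ∀ i j k, |T i j k| ≤ B) :
    ∃ (K : Type) (_ : Fintype K) (cA : K → ℝ) (leg : K → Fin 3 → LandauFree H × Fin 3),
      (∑ k, |cA k| ≤ 384 * B) ∧
      (∀ k (s s' : Fin 3), s ≠ s' → (leg k s).2 ≠ (leg k s').2) ∧
      (∀ k, cA k ≠ 0 → ∀ s, ∃ i : Fin 4,
        ((leg k s).1.1.1 : Literature.MathematicalPhysics.QuantumLattice.ZdEdge 4) = plaqEdge x μ ν i) ∧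
      ∀ a : LandauFree H → E3, tripleForm T (plaqVar H x μ ν a) = ∑ k, cA k * ∏ s : Fin 3, a (leg k s).1 (leg k s).2 := by
  classical
  obtain ⟨col, sg, hcol, hsg, hexp⟩ := triple_product_expansion
  let K : Type := ((Fin 4 × Fin 4 × Fin 4) × Fin 6) × (LandauFree H × LandauFree H × LandauFree H)
  let δ : LandauFree H → Fin 4 → ℝ := fun e i =>
    if (e.1.1 : Literature.MathematicalPhysics.QuantumLattice.ZdEdge 4) = plaqEdge x μ ν i then 1 else 0
  let cA : K → ℝ := fun k => T k.1.1.1 k.1.1.2.1 k.1.1.2.2 * sg k.1.2 * (δ k.2.1 k.1.1.1 * δ k.2.2.1 k.1.1.2.1 * δ k.2.2.2 k.1.1.2.2)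
  let leg : K → Fin 3 → LandauFree H × Fin 3 := fun k s => (![k.2.1, k.2.2.1, k.2.2.2] s, col k.1.2 s)
  have hδnn : ∀ e i, 0 ≤ δ e i := fun e i => by
    simp only [δ]; split_ifs <;> norm_num
  -- at most one free edge sits on a given lattice edge
  have hδsum : ∀ i, ∑ e : LandauFree H, δ e i ≤ 1 := by
    intro i
    simp only [δ]
    rw [Finset.sum_boole]
    have hcard : (Finset.univ.filter fun e : LandauFree H =>
        (e.1.1 : Literature.MathematicalPhysics.QuantumLattice.ZdEdge 4) = plaqEdge x μ ν i).card ≤ 1 := by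
      refine Finset.card_le_one.2 fun e he e' he' => ?_
      rw [Finset.mem_filter] at he he'
      exact landauFree_ext (he.2.trans he'.2.symm)
    exact_mod_cast hcard
  have hB : 0 ≤ B := (abs_nonneg _).trans (hT 0 0 0)
  refine ⟨K, inferInstance, cA, leg, ?_, ?_, ?_, ?_⟩
  · -- Σ |cA| ≤ Σ_{ijk,t} B · (Σ_e δ)(Σ_e δ)(Σ_e δ) ≤ 384·B
    have hterm : ∀ k : K, |cA k| ≤ B * (δ k.2.1 k.1.1.1 * δ k.2.2.1 k.1.1.2.1 * δ k.2.2.2 k.1.1.2.2) := by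
      intro k
      have hnn : 0 ≤ δ k.2.1 k.1.1.1 * δ k.2.2.1 k.1.1.2.1 * δ k.2.2.2 k.1.1.2.2 :=
        mul_nonneg (mul_nonneg (hδnn _ _) (hδnn _ _)) (hδnn _ _)
      simp only [cA]
      rw [abs_mul, abs_mul, hsg, mul_one, abs_of_nonneg hnn]
      exact mul_le_mul_of_nonneg_right (hT _ _ _) hnn
    have htriple : ∀ i j k : Fin 4,
        ∑ e₁ : LandauFree H, ∑ e₂ : LandauFree H, ∑ e₃ : LandauFree H, δ e₁ i * δ e₂ j * δ e₃ k ≤ 1 := by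
      intro i j k
      have h3 : ∑ e₁ : LandauFree H, ∑ e₂ : LandauFree H, ∑ e₃ : LandauFree H, δ e₁ i * δ e₂ j * δ e₃ k =
          (∑ e₁ : LandauFree H, δ e₁ i) * ((∑ e₂ : LandauFree H, δ e₂ j) * ∑ e₃ : LandauFree H, δ e₃ k) := by
        simp_rw [Finset.sum_mul, Finset.mul_sum, mul_assoc]
      rw [h3]
      have n2 : 0 ≤ ∑ e : LandauFree H, δ e j := Finset.sum_nonneg fun e _ => hδnn _ _
      have n3 : 0 ≤ ∑ e : LandauFree H, δ e k := Finset.sum_nonneg fun e _ => hδnn _ _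
      exact mul_le_one₀ (hδsum i) (mul_nonneg n2 n3) (mul_le_one₀ (hδsum j) n3 (hδsum k))
    calc ∑ k, |cA k| ≤ ∑ k : K, B * (δ k.2.1 k.1.1.1 * δ k.2.2.1 k.1.1.2.1 * δ k.2.2.2 k.1.1.2.2) :=
          Finset.sum_le_sum fun k _ => hterm k
      _ = ∑ q : (Fin 4 × Fin 4 × Fin 4) × Fin 6, B * ∑ e₁ : LandauFree H, ∑ e₂ : LandauFree H, ∑ e₃ : LandauFree H,
            δ e₁ q.1.1 * δ e₂ q.1.2.1 * δ e₃ q.1.2.2 := by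
          simp only [K, Fintype.sum_prod_type, Finset.mul_sum]
      _ ≤ ∑ _q : (Fin 4 × Fin 4 × Fin 4) × Fin 6, B * 1 :=
          Finset.sum_le_sum fun q _ => mul_le_mul_of_nonneg_left (htriple _ _ _) hB
      _ = 384 * B := by
          rw [Finset.sum_const, Finset.card_univ, nsmul_eq_mul, mul_one]
          simp only [Fintype.card_prod, Fintype.card_fin]
          norm_num
  · -- distinct colours inside a monomial: the colour of leg `s` is `col t s`, `col t` injective
    intro k s s' hss' h
    exact hss' (hcol k.1.2 h)
  · -- legs of non-zero monomials sit on plaquette edges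
    intro k hk s
    have key : ∀ e i, δ e i ≠ 0 →
        ((e.1.1 : Literature.MathematicalPhysics.QuantumLattice.ZdEdge 4) = plaqEdge x μ ν i) := by
      intro e i h
      by_contra hc
      exact h (by simp only [δ, if_neg hc])
    have hne : δ k.2.1 k.1.1.1 ≠ 0 ∧ δ k.2.2.1 k.1.1.2.1 ≠ 0 ∧ δ k.2.2.2 k.1.1.2.2 ≠ 0 := by
      refine ⟨fun h => hk ?_, fun h => hk ?_, fun h => hk ?_⟩ <;> simp only [cA, h, mul_zero, zero_mul]
    fin_cases s
    · exact ⟨k.1.1.1, key _ _ hne.1⟩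
    · exact ⟨k.1.1.2.1, key _ _ hne.2.1⟩
    · exact ⟨k.1.1.2.2, key _ _ hne.2.2⟩
  · -- the expansion itself
    intro a
    have hv : ∀ (i : Fin 4) (c : Fin 3), WithLp.ofLp (plaqVar H x μ ν a i) c = ∑ e : LandauFree H, δ e i * a e c := by
      intro i c
      simp only [plaqVar, δ]
      rw [freeVec_apply_eq_sum]
      refine Finset.sum_congr rfl fun e _ => ?_
      split_ifs <;> simp
    have hR : ∑ k : K, cA k * ∏ s : Fin 3, a (leg k s).1 (leg k s).2 =
        ∑ i : Fin 4, ∑ j : Fin 4, ∑ k : Fin 4, ∑ t : Fin 6, ∑ e₁ : LandauFree H, ∑ e₂ : LandauFree H, ∑ e₃ : LandauFree H,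
          T i j k * sg t * (δ e₁ i * δ e₂ j * δ e₃ k) * (a e₁ (col t 0) * a e₂ (col t 1) * a e₃ (col t 2)) := by
      simp only [K, cA, leg, Fintype.sum_prod_type, Fin.prod_univ_three, Matrix.cons_val_zero, Matrix.cons_val_one,
        Matrix.cons_val_two, Matrix.head_cons, Matrix.tail_cons]
    have hdist : ∀ (c : ℝ) (f g h : LandauFree H → ℝ),
        c * ((∑ e, f e) * (∑ e, g e) * ∑ e, h e) = ∑ e₁, ∑ e₂, ∑ e₃, c * (f e₁ * g e₂ * h e₃) := by
      intro c f g h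
      rw [Finset.sum_mul_sum, Finset.sum_mul, Finset.mul_sum]
      refine Finset.sum_congr rfl fun e₁ _ => ?_
      rw [Finset.sum_mul, Finset.mul_sum]
      refine Finset.sum_congr rfl fun e₂ _ => ?_
      rw [Finset.mul_sum, Finset.mul_sum]
    rw [hR]
    unfold tripleForm
    refine Finset.sum_congr rfl fun i _ => Finset.sum_congr rfl fun j _ => Finset.sum_congr rfl fun k _ => ?_
    rw [hexp, Finset.mul_sum]
    refine Finset.sum_congr rfl fun t _ => ?_
    rw [hv, hv, hv, ← mul_assoc,
      hdist (T i j k * sg t) (fun e => δ e i * a e (col t 0)) (fun e => δ e j * a e (col t 1)) (fun e => δ e k * a e (col t 2))]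
    refine Finset.sum_congr rfl fun e₁ _ => Finset.sum_congr rfl fun e₂ _ => Finset.sum_congr rfl fun e₃ _ => ?_
    ring

/-! ## §4 The triple bond: a pair of vertices only cross-contracts -/

/-- ★ **Triple-bond bound for a pair of triple-product vertices.**  If every cross propagator `(2β)⁻¹·[c=c']·G_H(e,e')` between a free edge `e` on
the plaquette `(x,μ,ν)` and a free edge `e'` on `(y,μ',ν')` is at most `M` in absolute value, and `|T|, |T'| ≤ B`, then
`|∫ tripleForm T (plaqVar_x a) · tripleForm T' (plaqVar_y a) · e^{−β Σ_c a^c·hodgeQ·a^c} da| ≤ Z · 15·M³ · (384·B)²`. -/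
theorem abs_integral_tripleForm_mul_tripleForm_le (H : ℕ) {β : ℝ} (hβ : 0 < β) (x y : Site 4) (μ ν μ' ν' : Fin 4)
    (T T' : Fin 4 → Fin 4 → Fin 4 → ℝ) {B : ℝ} (hT : ∀ i j k, |T i j k| ≤ B) (hT' : ∀ i j k, |T' i j k| ≤ B) {M : ℝ} (hM : 0 ≤ M)
    (hcross : ∀ (e e' : LandauFree H) (i i' : Fin 4),
      (e.1.1 : Literature.MathematicalPhysics.QuantumLattice.ZdEdge 4) = plaqEdge x μ ν i →
      (e'.1.1 : Literature.MathematicalPhysics.QuantumLattice.ZdEdge 4) = plaqEdge y μ' ν' i' →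
      ∀ c c' : Fin 3, |(2 * β)⁻¹ * (if c = c' then (hodgeQ H)⁻¹ e e' else 0)| ≤ M) :
    |∫ a : LandauFree H → E3, tripleForm T (plaqVar H x μ ν a) * tripleForm T' (plaqVar H y μ' ν' a) *
        Real.exp (-(β * ∑ c : Fin 3, (fun e => a e c) ⬝ᵥ (hodgeQ H *ᵥ fun e => a e c)))| ≤
      Real.sqrt (Real.pi / β) ^ Fintype.card (LandauFree H × Fin 3) / Real.sqrt (hodgeQ H ⊗ₖ (1 : Matrix (Fin 3) (Fin 3) ℝ)).det *
        (15 * M ^ 3) * (384 * B) ^ 2 := by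
  classical
  obtain ⟨K, _, cA, leg, hsum, hcolA, hedge, hexpA⟩ := tripleForm_plaqVar_expansion H x μ ν T hT
  obtain ⟨K', _, cB, leg', hsum', hcolB, hedge', hexpB⟩ := tripleForm_plaqVar_expansion H y μ' ν' T' hT'
  have hZ := partitionConst_pos (hodgeQ H) (hodgeQ_posDef H) hβ (I := LandauFree H)
  have hB : 0 ≤ B := (abs_nonneg _).trans (hT 0 0 0)
  simp_rw [hexpA, hexpB]
  rw [integral_sumProd_mul_sumProd (hodgeQ H) (hodgeQ_posDef H) hβ Finset.univ Finset.univ cA cB leg leg']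
  -- term by term: a zero coefficient kills the term, otherwise the two-vertex bound applies
  have hterm : ∀ (k : K) (l : K'),
      |cA k * cB l * ∫ a : LandauFree H → E3,
          (∏ s : Fin 3 ⊕ Fin 3, a ((Sum.elim (leg k) (leg' l)) s).1 ((Sum.elim (leg k) (leg' l)) s).2) *
            Real.exp (-(β * ∑ c : Fin 3, (fun e => a e c) ⬝ᵥ (hodgeQ H *ᵥ fun e => a e c)))| ≤
        |cA k| * |cB l| * (Real.sqrt (Real.pi / β) ^ Fintype.card (LandauFree H × Fin 3) /
          Real.sqrt (hodgeQ H ⊗ₖ (1 : Matrix (Fin 3) (Fin 3) ℝ)).det * (15 * M ^ 3)) := by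
    intro k l
    rw [abs_mul, abs_mul]
    by_cases hk : cA k = 0
    · simp only [hk, abs_zero, zero_mul, le_refl]
    by_cases hl : cB l = 0
    · simp only [hl, abs_zero, zero_mul, mul_zero, le_refl]
    refine mul_le_mul_of_nonneg_left ?_ (mul_nonneg (abs_nonneg _) (abs_nonneg _))
    have hAB : ∀ i j, |(2 * β)⁻¹ * (if (leg k i).2 = (leg' l j).2 then (hodgeQ H)⁻¹ (leg k i).1 (leg' l j).1 else 0)| ≤ M := by
      intro i j
      obtain ⟨i₀, hi₀⟩ := hedge k hk i
      obtain ⟨j₀, hj₀⟩ := hedge' l hl j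
      exact hcross _ _ i₀ j₀ hi₀ hj₀ _ _
    have h := abs_integral_twoVertex_le (hodgeQ H) (hodgeQ_posDef H) hβ (m := 3) (m' := 3) (k := 3)
      (finSumFinEquiv.trans (finCongr (show 3 + 3 = 2 * 3 by norm_num))) (leg k) (leg' l) (hcolA k) (hcolB l) hM hAB
    have h15 : ((2 * 3 - 1)‼ : ℕ) = 15 := by decide
    rw [h15] at h
    exact_mod_cast h
  have hsA : 0 ≤ ∑ k, |cA k| := Finset.sum_nonneg fun k _ => abs_nonneg _
  have hsB : 0 ≤ ∑ l, |cB l| := Finset.sum_nonneg fun l _ => abs_nonneg _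
  calc _ ≤ ∑ k, |∑ l, cA k * cB l * ∫ a : LandauFree H → E3,
            (∏ s : Fin 3 ⊕ Fin 3, a ((Sum.elim (leg k) (leg' l)) s).1 ((Sum.elim (leg k) (leg' l)) s).2) *
              Real.exp (-(β * ∑ c : Fin 3, (fun e => a e c) ⬝ᵥ (hodgeQ H *ᵥ fun e => a e c)))| :=
        Finset.abs_sum_le_sum_abs _ _
    _ ≤ ∑ k, ∑ l, |cA k * cB l * ∫ a : LandauFree H → E3,
            (∏ s : Fin 3 ⊕ Fin 3, a ((Sum.elim (leg k) (leg' l)) s).1 ((Sum.elim (leg k) (leg' l)) s).2) *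
              Real.exp (-(β * ∑ c : Fin 3, (fun e => a e c) ⬝ᵥ (hodgeQ H *ᵥ fun e => a e c)))| :=
        Finset.sum_le_sum fun k _ => Finset.abs_sum_le_sum_abs _ _
    _ ≤ ∑ k, ∑ l, |cA k| * |cB l| * (Real.sqrt (Real.pi / β) ^ Fintype.card (LandauFree H × Fin 3) /
          Real.sqrt (hodgeQ H ⊗ₖ (1 : Matrix (Fin 3) (Fin 3) ℝ)).det * (15 * M ^ 3)) :=
        Finset.sum_le_sum fun k _ => Finset.sum_le_sum fun l _ => hterm k l
    _ = (∑ k, |cA k|) * (∑ l, |cB l|) * (Real.sqrt (Real.pi / β) ^ Fintype.card (LandauFree H × Fin 3) /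
          Real.sqrt (hodgeQ H ⊗ₖ (1 : Matrix (Fin 3) (Fin 3) ℝ)).det * (15 * M ^ 3)) := by
        rw [Finset.sum_mul_sum, Finset.sum_mul]
        refine Finset.sum_congr rfl fun k _ => ?_
        rw [Finset.sum_mul]
    _ ≤ (384 * B) * (384 * B) * (Real.sqrt (Real.pi / β) ^ Fintype.card (LandauFree H × Fin 3) /
          Real.sqrt (hodgeQ H ⊗ₖ (1 : Matrix (Fin 3) (Fin 3) ℝ)).det * (15 * M ^ 3)) := by
        have h1 : (∑ k, |cA k|) * (∑ l, |cB l|) ≤ (384 * B) * (384 * B) :=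
          mul_le_mul hsum hsum' hsB (mul_nonneg (by norm_num) hB)
        have h2 : 0 ≤ Real.sqrt (Real.pi / β) ^ Fintype.card (LandauFree H × Fin 3) /
            Real.sqrt (hodgeQ H ⊗ₖ (1 : Matrix (Fin 3) (Fin 3) ℝ)).det * (15 * M ^ 3) :=
          mul_nonneg hZ.le (mul_nonneg (by norm_num) (pow_nonneg hM 3))
        exact mul_le_mul_of_nonneg_right h1 h2
    _ = _ := by ring

end EdgeChartGaussian

end Summit.QuantumFields.YangMills.Theorems.AllWindowsColdBoxBoxHighLine

end
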